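import Summits.PneNP.PneNP.Theorems.ChebyshevTracialDesignAlignedDipoleRecursion
import HarnessLib

/-!
# Cell pnp-psdrank, route `ChebyshevTracialDesign`: the TIGHT LEVEL DOMINATES — `|s_κ(c)| ≤ s_κ(1)` for every odd
# level `c` and every layer `2κ` (combinatorial form)

Harmonic backbone of the `r = 1` rung of the crux `TracialDecayExp20` (stmt-PneNP-19878), eng g8, part 3 of 3.
For a perfect matching `M` of `S` with `N` edges containing an aligned family of `κ` head and `κ` tail pairs (part 2), an
odd cut size `t = c + 2i = 2l+1 ≤ N − 1` and `κ ≤ l`: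
  `|Σ_{#cr=c, #in=i} Φ_κ| · #{#cr=1, #in=l} ≤ (Σ_{#cr=1, #in=l} Φ_κ) · #{#cr=c, #in=i}`   (`aligned_level_sum_dominance`),
i.e. the level sum of the aligned dipole product normalised by the size of its level class — the cut-side reading
`s_κ(c) = E[Φ_κ | level c]` of the bi-mode coefficient `σ̃_{2κ}(c)` of prover g5's (★) (`…LevelColumnSums`) — is largest in
absolute value at the TIGHT level `c = 1`, with constant `1`. By the level-independence of the matching-side functional
((★): all level kernels map the layer `2κ` onto the same `Π_p`), the layer-`2κ` eigenvalue of the Gram kernel of level `c`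
is `∝ s_κ(c)²` with a `c`-independent factor, so this is `σ_{2κ}(c) ≤ σ_{2κ}(1)`: the attenuation (ATT) of R1-SKELETON
S3(iii) at EVERY level follows from the tight level (prover g6 `…TightEigenDecay`, `…TightEvenProduct`), deep modes
included. Proof: induction on `κ` by the two-term recursion of part 2; the step is the one inequality
`i(N−c−i) + c(c−1)/4 ≤ l(N−1−l)`, i.e. `(c−1)(2N−2c−1) ≥ 0`, fed by the two ratio identities of the level law
`T(m;a,b) = C(m,a+b)C(a+b,b)2^a` (`levelCount_internal_step`, `levelCount_crossing_step`). At `t = N` (`c = t`) the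
inequality is false, which is why `t + 1 ≤ N` (the route's `2t + 2 ≤ n`) is assumed. Numerics: exact check of the
normalised profile on all odd `c ≤ t < n/2`, `κ ≤ l`, `n ≤ 200` (seat work/num/level_ratio.py, 0 violations).
[cite: Rothvoss2017, §2 (PDF p. 6)] [cite: GodsilMeagher2015, §15.2 (perfect matching scheme)]
Stature: support/instrument. WHAT THIS IS NOT: not the eigenvalue statement itself (that is the transfer through (★) and
lit's `sum_sq_gram_ladder`), not (L2)/SNT, nothing on psd rank, no P-vs-NP content. No definitions. Supports stmt-PneNP-19878.
-/

set_option linter.dupNamespace false -- `Summit.PneNP.PneNP.…`: summit = sub-problem (D-0017)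

namespace Summit.PneNP.PneNP.Theorems.ChebyshevTracialDesignAlignedDipoleDominance

open Finset Literature.Barriers.PneNP Summit.PneNP.PneNP.Theorems.ChebyshevTracialDesignJunta
open Summit.PneNP.PneNP.Theorems.ChebyshevTracialDesignAlignedDipolePeel
open Summit.PneNP.PneNP.Theorems.ChebyshevTracialDesignAlignedDipoleRecursion

variable {V : Type*} [DecidableEq V]

/-! ### §5 Sizes of the level classes: two ratio identities -/

/-- **One more internal edge**: `N(N−1)·T(N−2; c, i) = (i+1)(N−c−i−1)·T(N; c, i+1)` for the level-class sizes
`T(m; a, b) = C(m, a+b)·C(a+b, b)·2^a` (`…Junta.card_filter_cr_in_eq`). [folklore] -/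
theorem levelCount_internal_step (N c i : ℕ) (h : c + i + 2 ≤ N) :
    N * (N - 1) * ((N - 2).choose (c + i) * (c + i).choose i * 2 ^ c) =
      (i + 1) * (N - c - i - 1) * (N.choose (c + (i + 1)) * (c + (i + 1)).choose (i + 1) * 2 ^ c) := by
  have h1 : N * (N - 1).choose (c + i) = N.choose (c + i + 1) * (c + i + 1) := by
    have := Nat.add_one_mul_choose_eq (N - 1) (c + i)
    rwa [show N - 1 + 1 = N by omega] at this
  have h2 : (N - 2).choose (c + i) * (N - 1) = (N - 1).choose (c + i) * (N - 1 - (c + i)) := by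
    have := Nat.choose_mul_succ_eq (N - 2) (c + i)
    rwa [show N - 2 + 1 = N - 1 by omega] at this
  have h3 : (c + i + 1) * (c + i).choose i = (c + i + 1).choose (i + 1) * (i + 1) := Nat.add_one_mul_choose_eq _ _
  rw [show c + (i + 1) = c + i + 1 by omega, show N - c - i - 1 = N - 1 - (c + i) by omega]
  calc N * (N - 1) * ((N - 2).choose (c + i) * (c + i).choose i * 2 ^ c)
      = N * ((N - 2).choose (c + i) * (N - 1)) * ((c + i).choose i * 2 ^ c) := by ring
    _ = N * ((N - 1).choose (c + i) * (N - 1 - (c + i))) * ((c + i).choose i * 2 ^ c) := by rw [h2]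
    _ = (N - 1 - (c + i)) * (N * (N - 1).choose (c + i)) * ((c + i).choose i * 2 ^ c) := by ring
    _ = (N - 1 - (c + i)) * (N.choose (c + i + 1) * (c + i + 1)) * ((c + i).choose i * 2 ^ c) := by rw [h1]
    _ = (N - 1 - (c + i)) * N.choose (c + i + 1) * ((c + i + 1) * (c + i).choose i) * 2 ^ c := by ring
    _ = (N - 1 - (c + i)) * N.choose (c + i + 1) * ((c + i + 1).choose (i + 1) * (i + 1)) * 2 ^ c := by rw [h3]
    _ = (i + 1) * (N - 1 - (c + i)) * (N.choose (c + i + 1) * (c + i + 1).choose (i + 1) * 2 ^ c) := by ring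

/-- **Two more crossing edges**: `4N(N−1)·T(N−2; c, i) = (c+2)(c+1)·T(N; c+2, i)`. [folklore] -/
theorem levelCount_crossing_step (N c i : ℕ) (h : c + i + 2 ≤ N) :
    4 * (N * (N - 1)) * ((N - 2).choose (c + i) * (c + i).choose i * 2 ^ c) =
      (c + 2) * (c + 1) * (N.choose (c + 2 + i) * (c + 2 + i).choose i * 2 ^ (c + 2)) := by
  -- matching side
  have h1 : N * (N - 1).choose (c + i + 1) = N.choose (c + i + 2) * (c + i + 2) := by
    have := Nat.add_one_mul_choose_eq (N - 1) (c + i + 1)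
    rwa [show N - 1 + 1 = N by omega] at this
  have h2 : (N - 1) * (N - 2).choose (c + i) = (N - 1).choose (c + i + 1) * (c + i + 1) := by
    have := Nat.add_one_mul_choose_eq (N - 2) (c + i)
    rwa [show N - 2 + 1 = N - 1 by omega] at this
  -- binomial side, through the symmetric entries `C(c+i, c)`
  have hs1 : (c + i).choose i = (c + i).choose c := (Nat.choose_symm_add (a := c) (b := i)).symm
  have hs2 : (c + 2 + i).choose i = (c + i + 2).choose (c + 2) := by
    rw [show c + 2 + i = (c + 2) + i by omega, ← Nat.choose_symm_add (a := c + 2) (b := i),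
      show c + 2 + i = c + i + 2 by omega]
  have h3 : (c + i + 1) * (c + i).choose c = (c + i + 1).choose (c + 1) * (c + 1) := Nat.add_one_mul_choose_eq _ _
  have h4 : (c + i + 2) * (c + i + 1).choose (c + 1) = (c + i + 2).choose (c + 2) * (c + 2) := by
    have := Nat.add_one_mul_choose_eq (c + i + 1) (c + 1)
    rwa [show c + i + 1 + 1 = c + i + 2 by omega, show c + 1 + 1 = c + 2 by omega] at this
  rw [hs1, hs2, show c + 2 + i = c + i + 2 by omega, pow_add]
  calc 4 * (N * (N - 1)) * ((N - 2).choose (c + i) * (c + i).choose c * 2 ^ c)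
      = 4 * N * ((N - 1) * (N - 2).choose (c + i)) * ((c + i).choose c * 2 ^ c) := by ring
    _ = 4 * N * ((N - 1).choose (c + i + 1) * (c + i + 1)) * ((c + i).choose c * 2 ^ c) := by rw [h2]
    _ = 4 * (N * (N - 1).choose (c + i + 1)) * ((c + i + 1) * (c + i).choose c) * 2 ^ c := by ring
    _ = 4 * (N.choose (c + i + 2) * (c + i + 2)) * ((c + i + 1).choose (c + 1) * (c + 1)) * 2 ^ c := by
        rw [h1, h3]
    _ = 4 * N.choose (c + i + 2) * ((c + i + 2) * (c + i + 1).choose (c + 1)) * (c + 1) * 2 ^ c := by ring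
    _ = 4 * N.choose (c + i + 2) * ((c + i + 2).choose (c + 2) * (c + 2)) * (c + 1) * 2 ^ c := by rw [h4]
    _ = (c + 2) * (c + 1) * (N.choose (c + i + 2) * (c + i + 2).choose (c + 2) * (2 ^ c * 2 ^ 2)) := by ring

/-- `levelCount_internal_step` over `ℝ`. [folklore] -/
theorem levelCount_internal_step_real (N c i : ℕ) (h : c + i + 2 ≤ N) :
    (N : ℝ) * ((N : ℝ) - 1) * (((N - 2).choose (c + i) * (c + i).choose i * 2 ^ c : ℕ) : ℝ) =
      ((i : ℝ) + 1) * ((N : ℝ) - c - i - 1) *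
        ((N.choose (c + (i + 1)) * (c + (i + 1)).choose (i + 1) * 2 ^ c : ℕ) : ℝ) := by
  have h' := congrArg (Nat.cast (R := ℝ)) (levelCount_internal_step N c i h)
  push_cast [show 1 ≤ N by omega, show c ≤ N by omega, show i ≤ N - c by omega, show 1 ≤ N - c - i by omega]
    at h' ⊢
  linarith [h']

/-- `levelCount_crossing_step` over `ℝ`. [folklore] -/
theorem levelCount_crossing_step_real (N c i : ℕ) (h : c + i + 2 ≤ N) :
    4 * ((N : ℝ) * ((N : ℝ) - 1)) * (((N - 2).choose (c + i) * (c + i).choose i * 2 ^ c : ℕ) : ℝ) =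
      ((c : ℝ) + 2) * ((c : ℝ) + 1) * ((N.choose (c + 2 + i) * (c + 2 + i).choose i * 2 ^ (c + 2) : ℕ) : ℝ) := by
  have h' := congrArg (Nat.cast (R := ℝ)) (levelCount_crossing_step N c i h)
  push_cast [show 1 ≤ N by omega] at h' ⊢
  linarith [h']

/-! ### §6 Dominance of the tight level -/

section Dominance

variable (x x' y y' : ℕ → V)

/-- **The tight level dominates** (`σ_{2κ}(c) ≤ σ_{2κ}(1)`, combinatorial form). For `M` a perfect matching of `S`
with `N` edges containing the aligned family of `κ` head and `κ` tail pairs, an odd cut size `t = c + 2i = 2l + 1`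
with `t + 1 ≤ N` (i.e. `2l + 2 ≤ N`) and `κ ≤ l`:
`|Σ_{#cr = c, #in = i} Φ_κ| · #{#cr = 1, #in = l} ≤ (Σ_{#cr = 1, #in = l} Φ_κ) · #{#cr = c, #in = i}` —
the level sum of the aligned dipole product, normalised by the size of its level class, is largest in absolute
value at the tight level `c = 1`. Proof: induction on `κ` by the two-term recursion (`aligned_level_sum_succ`); the
step is the single inequality `i(N−c−i) + c(c−1)/4 ≤ l(N−1−l)`, i.e. `(c−1)(2N−2c−1) ≥ 0`. [folklore] -/
theorem aligned_level_sum_dominance : ∀ (κ : ℕ) {S : Finset V} {M : Finset (Sym2 V)}, IsPMOn S M →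
    (∀ j < κ, s(x j, x' j) ∈ M) → (∀ j < κ, s(y j, y' j) ∈ M) →
    (∀ j < κ, ∀ j' < κ, s(x j, x' j) = s(x j', x' j') → j = j') →
    (∀ j < κ, ∀ j' < κ, s(y j, y' j) = s(y j', y' j') → j = j') →
    (∀ j < κ, ∀ j' < κ, s(x j, x' j) ≠ s(y j', y' j')) → ∀ c i l : ℕ, c + 2 * i = 2 * l + 1 → κ ≤ l →
    2 * l + 2 ≤ M.card →
    |∑ U ∈ S.powerset.filter (fun U =>
        (M.filter fun e => cutCount U e = 1).card = c ∧ (M.filter fun e => cutCount U e = 2).card = i),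
        ∏ j ∈ range κ, ((if x j ∈ U then (1 : ℝ) else 0) - (if y j ∈ U then (1 : ℝ) else 0)) *
          ((if x' j ∈ U then (1 : ℝ) else 0) - (if y' j ∈ U then (1 : ℝ) else 0))| *
      ((S.powerset.filter (fun U =>
        (M.filter fun e => cutCount U e = 1).card = 1 ∧ (M.filter fun e => cutCount U e = 2).card = l)).card : ℝ) ≤
    (∑ U ∈ S.powerset.filter (fun U =>
        (M.filter fun e => cutCount U e = 1).card = 1 ∧ (M.filter fun e => cutCount U e = 2).card = l),
        ∏ j ∈ range κ, ((if x j ∈ U then (1 : ℝ) else 0) - (if y j ∈ U then (1 : ℝ) else 0)) *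
          ((if x' j ∈ U then (1 : ℝ) else 0) - (if y' j ∈ U then (1 : ℝ) else 0))) *
      ((S.powerset.filter (fun U =>
        (M.filter fun e => cutCount U e = 1).card = c ∧ (M.filter fun e => cutCount U e = 2).card = i)).card : ℝ) := by
  intro κ
  induction κ with
  | zero =>
    intro S M hM _ _ _ _ _ c i l _ _ _
    simp only [range_zero, prod_empty, sum_const, nsmul_eq_mul, mul_one, Nat.abs_cast]
    rw [mul_comm]
  | succ κ ih =>
    intro S M hM hx hy hxinj hyinj hxy c i l hcil hκl hN
    have hx' : ∀ j ≤ κ, s(x j, x' j) ∈ M := fun j hj => hx j (Nat.lt_succ_of_le hj)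
    have hy' : ∀ j ≤ κ, s(y j, y' j) ∈ M := fun j hj => hy j (Nat.lt_succ_of_le hj)
    have hxinj' : ∀ j ≤ κ, ∀ j' ≤ κ, s(x j, x' j) = s(x j', x' j') → j = j' :=
      fun j hj j' hj' => hxinj j (Nat.lt_succ_of_le hj) j' (Nat.lt_succ_of_le hj')
    have hyinj' : ∀ j ≤ κ, ∀ j' ≤ κ, s(y j, y' j) = s(y j', y' j') → j = j' :=
      fun j hj j' hj' => hyinj j (Nat.lt_succ_of_le hj) j' (Nat.lt_succ_of_le hj')
    have hxy' : ∀ j ≤ κ, ∀ j' ≤ κ, s(x j, x' j) ≠ s(y j', y' j') :=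
      fun j hj j' hj' => hxy j (Nat.lt_succ_of_le hj) j' (Nat.lt_succ_of_le hj')
    -- the reduced instance
    obtain ⟨hxr, hyr⟩ := aligned_restrict x x' y y' κ hx' hy' hxinj' hyinj' hxy'
    have hxinjr : ∀ j < κ, ∀ j' < κ, s(x j, x' j) = s(x j', x' j') → j = j' :=
      fun j hj j' hj' => hxinj j (by omega) j' (by omega)
    have hyinjr : ∀ j < κ, ∀ j' < κ, s(y j, y' j) = s(y j', y' j') → j = j' :=
      fun j hj j' hj' => hyinj j (by omega) j' (by omega)
    have hxyr : ∀ j < κ, ∀ j' < κ, s(x j, x' j) ≠ s(y j', y' j') := fun j hj j' hj' => hxy j (by omega) j' (by omega)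
    have hex : s(x κ, x' κ) ∈ M := hx' κ le_rfl
    have hey : s(y κ, y' κ) ∈ M := hy' κ le_rfl
    have hne : s(x κ, x' κ) ≠ s(y κ, y' κ) := hxy' κ le_rfl κ le_rfl
    have hxx' : x κ ≠ x' κ := fun h => hM.not_isDiag hex (Sym2.mk_isDiag_iff.2 h)
    have hyy' : y κ ≠ y' κ := fun h => hM.not_isDiag hey (Sym2.mk_isDiag_iff.2 h)
    have hxy1 : x κ ≠ y κ := fun h => hne (hM.unique hex hey (Sym2.mem_mk_left _ _) (h ▸ Sym2.mem_mk_left _ _))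
    have hxy2 : x κ ≠ y' κ :=
      fun h => hne (hM.unique hex hey (Sym2.mem_mk_left _ _) (h ▸ Sym2.mem_mk_right _ _))
    have hx'y : x' κ ≠ y κ :=
      fun h => hne (hM.unique hex hey (Sym2.mem_mk_right _ _) (h ▸ Sym2.mem_mk_left _ _))
    have hx'y' : x' κ ≠ y' κ :=
      fun h => hne (hM.unique hex hey (Sym2.mem_mk_right _ _) (h ▸ Sym2.mem_mk_right _ _))
    have hQS : ({x κ, x' κ, y κ, y' κ} : Finset V) ⊆ S := by
      intro w hw
      simp only [mem_insert, mem_singleton] at hw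
      rcases hw with rfl | rfl | rfl | rfl
      · exact hM.mem_of_mem hex (Sym2.mem_mk_left _ _)
      · exact hM.mem_of_mem hex (Sym2.mem_mk_right _ _)
      · exact hM.mem_of_mem hey (Sym2.mem_mk_left _ _)
      · exact hM.mem_of_mem hey (Sym2.mem_mk_right _ _)
    have hQM : IsPMOn ({x κ, x' κ, y κ, y' κ} : Finset V) {s(x κ, x' κ), s(y κ, y' κ)} := by
      have h1 := (IsPMOn.pair hxx').union (IsPMOn.pair hyy')
        (by simp [hxy1.symm, hxy2.symm, hx'y.symm, hx'y'.symm])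
      have e1 : ({x κ, x' κ} : Finset V) ∪ {y κ, y' κ} = {x κ, x' κ, y κ, y' κ} := by
        ext w; simp only [mem_union, mem_insert, mem_singleton]; tauto
      have e2 : ({s(x κ, x' κ)} : Finset (Sym2 V)) ∪ {s(y κ, y' κ)} = {s(x κ, x' κ), s(y κ, y' κ)} := by
        ext e; simp
      rwa [e1, e2] at h1
    have hM' : IsPMOn (S \ {x κ, x' κ, y κ, y' κ}) (M \ {s(x κ, x' κ), s(y κ, y' κ)}) := by
      have h' : IsPMOn (({x κ, x' κ, y κ, y' κ} : Finset V) ∪ (S \ {x κ, x' κ, y κ, y' κ})) M := by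
        rw [union_sdiff_of_subset hQS]; exact hM
      exact h'.sdiff disjoint_sdiff hQM (by
        intro e he
        simp only [mem_insert, mem_singleton] at he
        rcases he with rfl | rfl
        · exact hex
        · exact hey)
    have hcard' : (M \ {s(x κ, x' κ), s(y κ, y' κ)}).card = M.card - 2 := card_sdiff_pair x x' y y' κ hx' hy' hxy'
    -- abbreviations
    set S' := S \ {x κ, x' κ, y κ, y' κ} with hS'
    set M' := M \ {s(x κ, x' κ), s(y κ, y' κ)} with hM'def
    set N := M.card with hNdef
    have hl1 : 1 ≤ l := by omega
    -- the two recursions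
    have rec_c := aligned_level_sum_succ x x' y y' hM κ hx' hy' hxinj' hyinj' hxy' c i
    have rec_1 := aligned_level_sum_succ x x' y y' hM κ hx' hy' hxinj' hyinj' hxy' 1 l
    -- the tight recursion: second class empty, first = the tight class `(1, l-1)` of the reduced instance
    have hempty1 : S'.powerset.filter (fun U =>
        1 + (1 + (M'.filter fun e => cutCount U e = 1).card) = 1 ∧ (M'.filter fun e => cutCount U e = 2).card = l) = ∅ :=
      filter_eq_empty_iff.2 fun U _ h => by omega
    have hcongr1 : S'.powerset.filter (fun U =>
        (M'.filter fun e => cutCount U e = 1).card = 1 ∧ 1 + (M'.filter fun e => cutCount U e = 2).card = l) =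
        S'.powerset.filter (fun U =>
        (M'.filter fun e => cutCount U e = 1).card = 1 ∧ (M'.filter fun e => cutCount U e = 2).card = l - 1) :=
      filter_congr fun U _ => by omega
    rw [hempty1, sum_empty, mul_zero, sub_zero, hcongr1] at rec_1
    -- the reference sum `R` of the reduced instance is nonnegative (closed form)
    set R := ∑ U ∈ S'.powerset.filter (fun U =>
        (M'.filter fun e => cutCount U e = 1).card = 1 ∧ (M'.filter fun e => cutCount U e = 2).card = l - 1),
        ∏ j ∈ range κ, ((if x j ∈ U then (1 : ℝ) else 0) - (if y j ∈ U then (1 : ℝ) else 0)) *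
          ((if x' j ∈ U then (1 : ℝ) else 0) - (if y' j ∈ U then (1 : ℝ) else 0)) with hRdef
    have hR0 : 0 ≤ R := by
      rw [hRdef, aligned_level_sum_tight x x' y y' κ hM' hxr hyr hxinjr hyinjr hxyr (l - 1) (by omega)]
      positivity
    -- the key numbers, as reals
    have hP : (0 : ℝ) < (N : ℝ) * ((N : ℝ) - 1) := by
      have : (2 : ℝ) ≤ N := by exact_mod_cast (show 2 ≤ N by omega)
      nlinarith
    have hcR : (c : ℝ) + 2 * i = 2 * l + 1 := by exact_mod_cast hcil
    have hcN : (c : ℝ) + 1 ≤ N := by exact_mod_cast (show c + 1 ≤ N by omega)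
    have hc1 : (1 : ℝ) ≤ c := by exact_mod_cast (show 1 ≤ c by omega)
    -- level-class sizes (`…Junta.card_filter_cr_in_eq`)
    have hm₁ : ((S.powerset.filter (fun U =>
        (M.filter fun e => cutCount U e = 1).card = 1 ∧ (M.filter fun e => cutCount U e = 2).card = l)).card : ℝ) =
        ((N.choose (1 + l) * (1 + l).choose l * 2 ^ 1 : ℕ) : ℝ) := by
      rw [card_filter_cr_in_eq hM]
    have hmc : ((S.powerset.filter (fun U =>
        (M.filter fun e => cutCount U e = 1).card = c ∧ (M.filter fun e => cutCount U e = 2).card = i)).card : ℝ) =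
        ((N.choose (c + i) * (c + i).choose i * 2 ^ c : ℕ) : ℝ) := by
      rw [card_filter_cr_in_eq hM]
    obtain ⟨l₀, rfl⟩ : ∃ l₀, l = l₀ + 1 := ⟨l - 1, by omega⟩
    simp only [Nat.add_sub_cancel] at hcongr1 rec_1 hRdef hR0
    have hlpos : (0 : ℝ) < ((l₀ : ℝ) + 1) * ((N : ℝ) - 1 - l₀ - 1) := by
      have h2 : (l₀ : ℝ) + 3 ≤ N := by exact_mod_cast (show l₀ + 3 ≤ N by omega)
      have h3 : (0 : ℝ) ≤ l₀ := Nat.cast_nonneg _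
      nlinarith
    have hm₁'pos : (0 : ℝ) < (((N - 2).choose (1 + l₀) * (1 + l₀).choose l₀ * 2 ^ 1 : ℕ) : ℝ) := by
      have h1 : 0 < (N - 2).choose (1 + l₀) := Nat.choose_pos (by omega)
      have h2 : 0 < (1 + l₀).choose l₀ := Nat.choose_pos (by omega)
      exact_mod_cast Nat.mul_pos (Nat.mul_pos h1 h2) (by positivity)
    -- abbreviations for the two reduced sums and the three class sizes
    set A := ∑ U ∈ S'.powerset.filter (fun U =>
          (M'.filter fun e => cutCount U e = 1).card = c ∧ 1 + (M'.filter fun e => cutCount U e = 2).card = i),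
        ∏ j ∈ range κ, ((if x j ∈ U then (1 : ℝ) else 0) - (if y j ∈ U then (1 : ℝ) else 0)) *
          ((if x' j ∈ U then (1 : ℝ) else 0) - (if y' j ∈ U then (1 : ℝ) else 0)) with hAdef
    set B := ∑ U ∈ S'.powerset.filter (fun U =>
          1 + (1 + (M'.filter fun e => cutCount U e = 1).card) = c ∧ (M'.filter fun e => cutCount U e = 2).card = i),
        ∏ j ∈ range κ, ((if x j ∈ U then (1 : ℝ) else 0) - (if y j ∈ U then (1 : ℝ) else 0)) *
          ((if x' j ∈ U then (1 : ℝ) else 0) - (if y' j ∈ U then (1 : ℝ) else 0)) with hBdef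
    set m₁ : ℝ := ((N.choose (1 + (l₀ + 1)) * (1 + (l₀ + 1)).choose (l₀ + 1) * 2 ^ 1 : ℕ) : ℝ) with hm₁def
    set mc : ℝ := ((N.choose (c + i) * (c + i).choose i * 2 ^ c : ℕ) : ℝ) with hmcdef
    set m₁' : ℝ := (((N - 2).choose (1 + l₀) * (1 + l₀).choose l₀ * 2 ^ 1 : ℕ) : ℝ) with hm₁'def
    set P : ℝ := (N : ℝ) * ((N : ℝ) - 1) with hPdef
    have hmc0 : (0 : ℝ) ≤ mc := Nat.cast_nonneg _
    -- the head-pair-internal term `A`: `|A|·m₁'·P ≤ R·i(N−c−i)·mc`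
    have hA : |A| * m₁' * P ≤ R * ((i : ℝ) * ((N : ℝ) - c - i)) * mc := by
      rcases Nat.eq_zero_or_pos i with rfl | hi
      · have hempty : S'.powerset.filter (fun U =>
            (M'.filter fun e => cutCount U e = 1).card = c ∧ 1 + (M'.filter fun e => cutCount U e = 2).card = 0) = ∅ :=
          filter_eq_empty_iff.2 fun U _ h => by omega
        rw [hAdef, hempty, sum_empty]
        simp
      · obtain ⟨i₀, rfl⟩ : ∃ i₀, i = i₀ + 1 := ⟨i - 1, by omega⟩
        have hcongrA : S'.powerset.filter (fun U =>
            (M'.filter fun e => cutCount U e = 1).card = c ∧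
              1 + (M'.filter fun e => cutCount U e = 2).card = i₀ + 1) =
            S'.powerset.filter (fun U =>
            (M'.filter fun e => cutCount U e = 1).card = c ∧ (M'.filter fun e => cutCount U e = 2).card = i₀) :=
          filter_congr fun U _ => by omega
        have hIH := ih hM' hxr hyr hxinjr hyinjr hxyr c i₀ l₀ (by omega) (by omega) (by rw [hcard']; omega)
        rw [← hRdef, card_filter_cr_in_eq hM', card_filter_cr_in_eq hM', hcard', ← hm₁'def, ← hcongrA, ← hAdef]
          at hIH
        have hEA := levelCount_internal_step_real N c i₀ (by omega)
        rw [← hmcdef] at hEA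
        have hIH' : |A| * m₁' * P ≤ R * (((N - 2).choose (c + i₀) * (c + i₀).choose i₀ * 2 ^ c : ℕ) : ℝ) * P :=
          mul_le_mul_of_nonneg_right hIH hP.le
        calc |A| * m₁' * P ≤ R * (((N - 2).choose (c + i₀) * (c + i₀).choose i₀ * 2 ^ c : ℕ) : ℝ) * P := hIH'
          _ = R * (P * (((N - 2).choose (c + i₀) * (c + i₀).choose i₀ * 2 ^ c : ℕ) : ℝ)) := by ring
          _ = R * (((i₀ : ℝ) + 1) * ((N : ℝ) - c - i₀ - 1) * mc) := by rw [hPdef, hEA]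
          _ = _ := by push_cast; ring
    -- the both-pairs-crossing term `B`: `|B|·m₁'·4P ≤ R·c(c−1)·mc`
    have hB : |B| * m₁' * (4 * P) ≤ R * ((c : ℝ) * ((c : ℝ) - 1)) * mc := by
      by_cases hc : c < 2
      · have hempty : S'.powerset.filter (fun U =>
            1 + (1 + (M'.filter fun e => cutCount U e = 1).card) = c ∧
              (M'.filter fun e => cutCount U e = 2).card = i) = ∅ :=
          filter_eq_empty_iff.2 fun U _ h => by omega
        have hc1' : (c : ℝ) = 1 := by exact_mod_cast (show c = 1 by omega)
        rw [hBdef, hempty, sum_empty]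
        simp [hc1']
      · obtain ⟨c₀, rfl⟩ : ∃ c₀, c = c₀ + 2 := ⟨c - 2, by omega⟩
        have hcongrB : S'.powerset.filter (fun U =>
            1 + (1 + (M'.filter fun e => cutCount U e = 1).card) = c₀ + 2 ∧
              (M'.filter fun e => cutCount U e = 2).card = i) =
            S'.powerset.filter (fun U =>
            (M'.filter fun e => cutCount U e = 1).card = c₀ ∧ (M'.filter fun e => cutCount U e = 2).card = i) :=
          filter_congr fun U _ => by omega
        have hIH := ih hM' hxr hyr hxinjr hyinjr hxyr c₀ i l₀ (by omega) (by omega) (by rw [hcard']; omega)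
        rw [← hRdef, card_filter_cr_in_eq hM', card_filter_cr_in_eq hM', hcard', ← hm₁'def, ← hcongrB, ← hBdef]
          at hIH
        have hEB := levelCount_crossing_step_real N c₀ i (by omega)
        rw [← hmcdef] at hEB
        have h4P : (0 : ℝ) ≤ 4 * P := by linarith
        have hIH' : |B| * m₁' * (4 * P) ≤
            R * (((N - 2).choose (c₀ + i) * (c₀ + i).choose i * 2 ^ c₀ : ℕ) : ℝ) * (4 * P) :=
          mul_le_mul_of_nonneg_right hIH h4P
        calc |B| * m₁' * (4 * P)
            ≤ R * (((N - 2).choose (c₀ + i) * (c₀ + i).choose i * 2 ^ c₀ : ℕ) : ℝ) * (4 * P) := hIH'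
          _ = R * (4 * P * (((N - 2).choose (c₀ + i) * (c₀ + i).choose i * 2 ^ c₀ : ℕ) : ℝ)) := by ring
          _ = R * (((c₀ : ℝ) + 2) * ((c₀ : ℝ) + 1) * mc) := by rw [hPdef, hEB]
          _ = _ := by push_cast; ring
    -- the key inequality `i(N−c−i) + c(c−1)/4 ≤ l(N−1−l)`, i.e. `(c−1)(2N−2c−1) ≥ 0`
    have hkey : (i : ℝ) * ((N : ℝ) - c - i) + (c : ℝ) * ((c : ℝ) - 1) / 4 ≤
        ((l₀ : ℝ) + 1) * ((N : ℝ) - 1 - l₀ - 1) := by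
      push_cast at hcR
      have hi : (i : ℝ) = (2 * l₀ + 3 - c) / 2 := by linarith
      rw [hi]
      nlinarith [mul_nonneg (sub_nonneg.2 hc1) (show (0 : ℝ) ≤ 2 * N - 2 * c - 1 by linarith)]
    -- assemble: `|2A − 2B|·m₁·l(N−1−l) = |2A − 2B|·m₁'·P ≤ 2R·mc·(i(N−c−i) + c(c−1)/4) ≤ 2R·mc·l(N−1−l)`
    rw [rec_c, rec_1, hm₁, hmc]
    have htri : |2 * A - 2 * B| ≤ 2 * |A| + 2 * |B| := by
      have h := abs_sub (2 * A) (2 * B)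
      rwa [abs_mul, abs_mul, abs_two] at h
    have hE0' : P * m₁' = ((l₀ : ℝ) + 1) * ((N : ℝ) - 1 - l₀ - 1) * m₁ := by
      have h := levelCount_internal_step_real N 1 l₀ (by omega)
      rw [hPdef, hm₁'def, hm₁def]
      push_cast at h ⊢
      linarith [h]
    refine le_of_mul_le_mul_right ?_ hlpos
    calc |2 * A - 2 * B| * m₁ * (((l₀ : ℝ) + 1) * ((N : ℝ) - 1 - l₀ - 1))
        = |2 * A - 2 * B| * (P * m₁') := by rw [hE0']; ring
      _ ≤ (2 * |A| + 2 * |B|) * (P * m₁') :=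
          mul_le_mul_of_nonneg_right htri (mul_nonneg hP.le hm₁'pos.le)
      _ = 2 * (|A| * m₁' * P) + (1 / 2) * (|B| * m₁' * (4 * P)) := by ring
      _ ≤ 2 * (R * ((i : ℝ) * ((N : ℝ) - c - i)) * mc) + (1 / 2) * (R * ((c : ℝ) * ((c : ℝ) - 1)) * mc) := by
          linarith [hA, hB]
      _ = 2 * R * mc * ((i : ℝ) * ((N : ℝ) - c - i) + (c : ℝ) * ((c : ℝ) - 1) / 4) := by ring
      _ ≤ 2 * R * mc * (((l₀ : ℝ) + 1) * ((N : ℝ) - 1 - l₀ - 1)) :=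
          mul_le_mul_of_nonneg_left hkey (mul_nonneg (mul_nonneg zero_le_two hR0) hmc0)

end Dominance

end Summit.PneNP.PneNP.Theorems.ChebyshevTracialDesignAlignedDipoleDominance
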